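import Literature.Topology.FourManifolds.GompfTwistLocality
import Literature.Topology.FourManifolds.GompfTubeStraightening
import Literature.Topology.FourManifolds.GompfFramedTwistOfFishtail
import HarnessLib

/-!
# F from fishtail twisting data for ONE tube-shear model

Assembly for the framed form of R. Gompf, *More Cappell–Shaneson spheres are standard*, Algebr.
Geom. Topol. 10 (2010), Theorem 2.1 / §4 ¶3 (the named fact
`Literature.Topology.FourManifolds.gompf2010_framedTwist`, **F**). `GompfFramedTwistOfFishtail.lean`
reduced F to fishtail twisting data for *every* straightening of *every* matrix in standard form.
Two further bricks make a single model suffice: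

* `GompfTubeStraightening.lean` (`exists_straightening_tubeShear`): every `B` in standard form has,
  in each straightening class, a straightening whose monodromy **is the fixed tube shear
  `tubeShear`** on the tube `|arg z₂|, |arg z₃| < tubeRad B` about the first coordinate circle `α`;
* `GompfTwistLocality.lean` (`exists_twistingDiffeo_transfer`): twisting data supported in the
  surgered twisted cylinder neighbourhood `twistNbhd ψ η V` (the bicollar of the sliver's fibre and
  the cylinder over the tube `V` — where Gompf's box `N`, punctured torus `F′`, disc `D` and fishtail
  neighbourhood live, proof of Thm 2.1) transfer between monodromies agreeing on `V`.

Hence **F follows from twisting data for one monodromy `ψ₀` which is the tube shear on some tube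
about `α`, provided the data can be taken supported over arbitrarily thin tubes**
(`Literature.Topology.FourManifolds.gompf2010_framedTwist_of_tubeShearModel`): Gompf's fishtail
diffeomorphism (Lemma 2.2 inside the fishtail neighbourhood, extended by the identity), which is
supported in any prescribed neighbourhood of `N ∪ D`, has to be constructed **once**. The radius
bookkeeping uses `nonempty_diffeomorph_prodSurgered_radius` and
`Straightening.nonempty_diffeomorph_prodSurgered_trans_farDehn` (any admissible product-tube
radius), so the model data are needed at one radius per tube only.

* `Literature.Topology.FourManifolds.axisTube r` — the open tube `{|arg z₂| < r, |arg z₃| < r}`;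
* the model hypothesis at tube radius `r` is spelled out as an existential over the data of
  `nonempty_diffeomorph_prodSurgered_of_twistingDiffeo` with support control (hypothesis `hdata` of
  the assembly; no named fact);
* `Literature.Topology.FourManifolds.gompf2010_framedTwist_of_tubeShearModel`.

Everything here is proved; no named facts are introduced.

## References

* R. E. Gompf, *More Cappell–Shaneson spheres are standard*, Algebr. Geom. Topol. 10 (2010)
  1665–1681: Thm 2.1 and its proof, Lemma 2.2, §4 ¶3. [GompfAGT2010]
-/

open scoped Manifold ContDiff Topology Real
open Set Function Metric Complex

noncomputable section

namespace Literature.Topology.FourManifolds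

/-- Local notation: `𝔼 n` is the model Euclidean space `EuclideanSpace ℝ (Fin n)`. -/
local notation "𝔼 " n:arg => EuclideanSpace ℝ (Fin n)

/-- Local notation: the model with corners `𝓣 = (𝓡 1).prod ((𝓡 1).prod (𝓡 1))` of `ThreeTorus`. -/
local notation "𝓣" =>
  (ModelWithCorners.prod (𝓡 1) (ModelWithCorners.prod (𝓡 1) (𝓡 1)))

/-! ### The open tube about the first coordinate circle -/

section Tube

/-- The arc `{|arg w| < r}` of the circle is open for `r ≤ π` (it misses `-1`, where `arg` jumps). [folklore] -/
theorem isOpen_abs_arg_lt {r : ℝ} (hr : r ≤ π) : IsOpen {w : Circle | |arg (w : ℂ)| < r} := by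
  refine isOpen_iff_mem_nhds.2 fun w hw ↦ ?_
  have hw' : |arg (w : ℂ)| < π := lt_of_lt_of_le hw hr
  have hslit : (w : ℂ) ∈ slitPlane := by
    refine mem_slitPlane_of_norm_eq_one (Circle.norm_coe w) fun h ↦ ?_
    have : arg (w : ℂ) = π := by rw [h, Complex.arg_neg_one]
    rw [this, abs_of_pos Real.pi_pos] at hw'
    exact lt_irrefl _ hw'
  have hc : ContinuousAt (fun w : Circle ↦ |arg (w : ℂ)|) w :=
    ((continuousAt_arg hslit).comp continuous_subtype_val.continuousAt).abs
  exact hc.preimage_mem_nhds (isOpen_Iio.mem_nhds hw)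

/-- **The open tube `{|arg z₂| < r, |arg z₃| < r}` about the first coordinate circle `α`.** [cite: GompfAGT2010, Thm 2.1 (proof: a neighbourhood of the cylinder over α)] -/
def axisTube {r : ℝ} (hr : r ≤ π) : TopologicalSpace.Opens ThreeTorus :=
  ⟨{z | |arg (z.2.1 : ℂ)| < r ∧ |arg (z.2.2 : ℂ)| < r},
    ((isOpen_abs_arg_lt hr).preimage (continuous_fst.comp continuous_snd)).inter
      ((isOpen_abs_arg_lt hr).preimage (continuous_snd.comp continuous_snd))⟩

/-- Membership in the tube. [folklore] -/
theorem mem_axisTube_iff {r : ℝ} (hr : r ≤ π) {z : ThreeTorus} :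
    z ∈ axisTube hr ↔ |arg (z.2.1 : ℂ)| < r ∧ |arg (z.2.2 : ℂ)| < r := Iff.rfl

/-- **Small exponential vectors land in the tube**: `expT v ∈ axisTube r` for `‖v‖ < r ≤ π`. [folklore] -/
theorem expT_mem_axisTube {r : ℝ} (hr : r ≤ π) {v : 𝔼 3} (hv : ‖v‖ < r) : expT v ∈ axisTube hr := by
  have hj : ∀ j, |v j| < r := fun j ↦
    lt_of_le_of_lt ((Real.norm_eq_abs _).symm.le.trans (PiLp.norm_apply_le v j)) hv
  have harg : ∀ j, arg ((Circle.exp (v j) : Circle) : ℂ) = v j := fun j ↦ by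
    have h := abs_lt.1 ((hj j).trans_le hr)
    exact Circle.arg_exp h.1 h.2.le
  rw [mem_axisTube_iff]
  constructor
  · show |arg ((Circle.exp (v 1) : Circle) : ℂ)| < r
    rw [harg]; exact hj 1
  · show |arg ((Circle.exp (v 2) : Circle) : ℂ)| < r
    rw [harg]; exact hj 2

end Tube


/-! ### The assembly -/

section Assembly

/-- The sliding family of the identity data is the identity. [folklore] -/
theorem slideFun_refl (s : ℝ) (x : ThreeTorus) :
    slideFun (Diffeotopy.refl 𝓣 ThreeTorus) (Diffeomorph.refl 𝓣 ThreeTorus ∞) s x = x := rfl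

/-- Small exponential vectors are off the far collar (for `ε ≤ 1`, `τ < π/2`). [folklore] -/
theorem expT_not_mem_farSupport_of_norm_lt {τ ε : ℝ} (hτ : 0 < τ) (hτ' : τ < π / 2) (hε1 : ε ≤ 1)
    {v : 𝔼 3} (hv : ‖v‖ < ε) : expT v ∉ farSupport τ := by
  refine expT_not_mem_farSupport hτ ?_
  have h1 : |v 1| ≤ ‖v‖ := (Real.norm_eq_abs _).symm.le.trans (PiLp.norm_apply_le v 1)
  linarith [Real.pi_gt_three]

set_option maxHeartbeats 800000 in
/-- **Gompf's framed Theorem 2.1 (F) from fishtail twisting data for ONE tube-shear model.** Let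
`ψ₀` be a monodromy of `T³` which is the tube shear `tubeShear` on the tube `axisTube r₁` about the
first coordinate circle `α` (e.g. the monodromy of `tubeStraightening A₀` for any fixed `A₀` in
standard form, `tubeStraightening_monodromy_apply`). If `ψ₀` carries tube-shear twisting data at
every tube radius `r ≤ r₁` (hypothesis `hdata`: a product-tube radius `ε ≤ r/2` on which `ψ₀` is the
identity, Gompf's far Dehn twist, a neighbourhood `V_δ` of the sliver in the bicollar, and a twisting
diffeomorphism which is the identity off a closed subset of the surgered twisted cylinder neighbourhood
`twistNbhd ψ₀ η (axisTube r)` — Gompf's fishtail diffeomorphism, supported over the tube of radius `r`), then **F** holds: for `B` in standard form with `det (B - 1) = 1` and any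
framing path `β`, `gompfSphere B β ≃ₘ gompfSphere (Δ B) (β.deltaLeft 1)` — take a straightening
`S` of `B` in the class of `β` with the tube shear as monodromy on `axisTube (tubeRad B)`
(`exists_straightening_tubeShear`), transfer the model data at radius `r = min r₁ (tubeRad B)` to
`S.monodromy` (`exists_twistingDiffeo_transfer`, identity sliding families), apply the twist
criterion (`nonempty_diffeomorph_prodSurgered_of_twistingDiffeo`) at the model's product-tube radius
and move radii (`nonempty_diffeomorph_prodSurgered_radius`,
`Straightening.nonempty_diffeomorph_prodSurgered_trans_farDehn`); conclude with
`gompf2010_framedTwist_of_one`. [cite: GompfAGT2010, Thm 2.1 and §4 ¶3 (X^{τ·σ}_B = X^σ_A for B = Δᵏ A)] -/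
theorem gompf2010_framedTwist_of_tubeShearModel (ψ₀ : ThreeTorus ≃ₘ⟮𝓣, 𝓣⟯ ThreeTorus) {r₁ : ℝ}
    (hr₁ : 0 < r₁) (hr₁π : r₁ ≤ π)
    (hψ₀ : ∀ z : ThreeTorus, |arg (z.2.1 : ℂ)| < r₁ → |arg (z.2.2 : ℂ)| < r₁ → ψ₀ z = tubeShear z)
    (hdata : ∀ (r : ℝ) (_ : 0 < r) (hrr : r ≤ r₁),
      ∃ (ε : ℝ) (hε : 0 < ε) (hεπ : ε ≤ π) (_ : ε ≤ r / 2) (_ : ε ≤ 1)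
        (hψ₀ : ∀ v : 𝔼 3, ‖v‖ < ε → ψ₀ (expT v) = expT v)
        (τ : ℝ) (hτ : 0 < τ) (hτ' : τ < π / 2) (η : ℝ) (_ : 0 < η)
        (Vδ : TopologicalSpace.Opens (ThreeTorus × ↥mappingTorusPieceTwo))
        (_ : fibreSliver (farSupport τ) ⊆ Vδ) (hV1 : ∀ b ∈ Vδ, b.1 ≠ 1)
        (_ : ∀ b ∈ Vδ, sliverTwist (farDehn hτ hτ').symm b ∈ Vδ) (_ : ∀ b ∈ Vδ, b ∈ bicollarPiece η)
        (G : ↥((prodTube ψ₀ ε hε hεπ hψ₀).localOpens (prodSliverCompl ψ₀ (isClosed_farSupport τ))) ≃ₘ⟮𝓡 4, 𝓡 4⟯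
          ↥((prodTube ψ₀ ε hε hεπ hψ₀).localOpens (prodSliverCompl ψ₀ (isClosed_farSupport τ))))
        (Ksupp : Set (prodSurgered ψ₀ ε hε hεπ hψ₀)),
        (∀ (x : ↥((prodTube ψ₀ ε hε hεπ hψ₀).localOpens (prodSliverCompl ψ₀ (isClosed_farSupport τ))))
            (b : ↥Vδ), (b : ThreeTorus × ↥mappingTorusPieceTwo) ∉ fibreSliver (farSupport τ) →
            (x : prodSurgered ψ₀ ε hε hεπ hψ₀) = (prodTube ψ₀ ε hε hεπ hψ₀).glueData.inl
              (opensToComplement (prodTube ψ₀ ε hε hεπ hψ₀) (mtGlueData ψ₀).inr Vδ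
                (inr_not_mem_range_secCircle_self ψ₀ hε hεπ hψ₀ Vδ hV1) b) →
            ∃ a' : ↥(prodTube ψ₀ ε hε hεπ hψ₀).complement,
              (a' : MTorus ψ₀) = (mtGlueData ψ₀).inr (sliverTwist (farDehn hτ hτ') b) ∧
                (G x : prodSurgered ψ₀ ε hε hεπ hψ₀) = (prodTube ψ₀ ε hε hεπ hψ₀).glueData.inl a') ∧
        IsClosed Ksupp ∧
        Ksupp ⊆ (prodTube ψ₀ ε hε hεπ hψ₀).localOpens
          (twistNbhd ψ₀ η (axisTube (hrr.trans hr₁π)) (Diffeotopy.refl 𝓣 ThreeTorus) (Diffeomorph.refl 𝓣 ThreeTorus ∞)) ∧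
        ∀ x : ↥((prodTube ψ₀ ε hε hεπ hψ₀).localOpens (prodSliverCompl ψ₀ (isClosed_farSupport τ))),
          (x : prodSurgered ψ₀ ε hε hεπ hψ₀) ∉ Ksupp → G x = x) :
    gompf2010_framedTwist := by
  refine gompf2010_framedTwist_of_one fun B hB _ β ↦ ?_
  -- a straightening of `B` in the class of `β` with the tube shear as monodromy on the tube
  obtain ⟨S, hβ, -, hSmono⟩ := exists_straightening_tubeShear B hB β
  set r : ℝ := min r₁ (tubeRad B) with hr_def
  have hr : 0 < r := lt_min hr₁ (tubeRad_pos B)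
  have hrr : r ≤ r₁ := min_le_left _ _
  have hrB : r ≤ tubeRad B := min_le_right _ _
  have hrπ : r ≤ π := hrr.trans hr₁π
  -- the model data at radius `r`
  have hd := hdata r hr hrr
  obtain ⟨ε, hε, hεπ, hεr, hε1, hψ₀ε, τ, hτ, hτ', η, hη, Vδ, hVS, hV1, hVg, hVη, G, Ksupp, hG, hKc, hKU, hGK⟩ := hd
  -- the two monodromies agree on the tube, and are the identity on the `ε`-ball
  have hagree : ∀ x ∈ axisTube hrπ, ψ₀ x = S.monodromy x := fun x hx ↦ by
    rw [mem_axisTube_iff] at hx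
    rw [hψ₀ x (hx.1.trans_le hrr) (hx.2.trans_le hrr), hSmono x (hx.1.trans_le hrB) (hx.2.trans_le hrB)]
  have hVε : ∀ v : 𝔼 3, ‖v‖ < ε → expT v ∈ axisTube hrπ := fun v hv ↦
    expT_mem_axisTube hrπ (hv.trans_le (by linarith))
  have hψ'ε : ∀ v : 𝔼 3, ‖v‖ < ε → S.monodromy (expT v) = expT v := fun v hv ↦ by
    rw [← hagree _ (hVε v hv), hψ₀ε v hv]
  have hSε : ∀ v : 𝔼 3, ‖v‖ < ε → expT v ∉ farSupport τ := fun v hv ↦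
    expT_not_mem_farSupport_of_norm_lt hτ hτ' hε1 hv
  -- transfer the data to `S.monodromy`
  have htr := exists_twistingDiffeo_transfer ψ₀ S.monodromy hε hεπ hψ₀ε hψ'ε hη (axisTube hrπ)
    (Diffeotopy.refl 𝓣 ThreeTorus) (Diffeotopy.refl 𝓣 ThreeTorus) (Diffeomorph.refl 𝓣 ThreeTorus ∞)
    (Diffeomorph.refl 𝓣 ThreeTorus ∞) hVε (fun _ _ _ ↦ rfl) (fun _ _ _ ↦ rfl) (fun _ _ _ _ _ ↦ rfl)
    (fun s _ _ x hx ↦ hagree x hx)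
    (farDehn hτ hτ') (isClosed_farSupport τ) hSε Vδ hV1 hVη G hG Ksupp hKc hKU hGK
  obtain ⟨G', -, -, -, -, hG'⟩ := htr
  -- the twist criterion at the model radius, then radius bookkeeping
  have hcrit := nonempty_diffeomorph_prodSurgered_of_twistingDiffeo S.monodromy hε hεπ hψ'ε
    (farDehn hτ hτ') (isClosed_farSupport τ) (fun y hy ↦ farDehn_eq_self hτ hτ' hy) hSε Vδ hVS hV1 hVg G' hG'
  have e1 : Nonempty (gompfSphere B β ≃ₘ⟮𝓡 4, 𝓡 4⟯ S.prodSphere) :=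
    S.nonempty_diffeomorph_gompfSphere_prodSphere_of_homotopic β hβ
  have e2 := nonempty_diffeomorph_prodSurgered_radius S.monodromy S.prodRad_pos S.prodRad_le_pi
    S.monodromy_expT_of_norm_lt hε hεπ hψ'ε
  have e4 := S.nonempty_diffeomorph_prodSurgered_trans_farDehn hτ hτ' hε hεπ
    (trans_apply_expT_of_norm_lt S.monodromy hψ'ε (farDehn hτ hτ') (fun y hy ↦ farDehn_eq_self hτ hτ' hy) hSε) β hβ
  exact nonempty_diffeomorph_trans e1 (nonempty_diffeomorph_trans e2 (nonempty_diffeomorph_trans hcrit e4))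

end Assembly

end Literature.Topology.FourManifolds
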